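import Summits.QuantumFields.GaugeBoot.ZdCentralTwistTorusLoops
import HarnessLib

/-!
# The staggered central twist on every closed loop of the even torus: the cell's gauge groups
# `SU(2n)` and `U(N)` (gauge-boot, L3 structural supplement; `ℤ^d` twist 12b)

HONEST FRAMING (cell `pub-gaugeboot`, page 1 of every file): the venture produces certified bounds
on lattice expectations at stated coupling, gauge group, dimension and torus size; NOT a mass gap,
NOT a continuum limit, NOT a string tension; NOT Yang–Mills-summit-bearing (barriers
`FixedCouplingUltralocality`, `PerturbativeInvisibility`). This module bounds no expectation; no
certificate of the cell sits at `β < 0` (a mirror value at `-β` obtained from a torus expectation at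
`β` by the sign rule is a COROLLARY of that expectation, not a new certificate).

`ZdCentralTwistTorusLoops.lean` (twist 12) proved, for a compact group with a central involution `z`
and a representation with `ρ z = -1`, on the even torus `(ℤ/L)^d`: every closed torus loop (a `ℤ^d`
walk `w : x ⟶ y` with `y ≡ x (mod L)`, read through the periodic lift) satisfies
`⟨χ_ρ(hol_w ∘ lift)⟩_{L,-β} = (-1)^{a(w)} ⟨χ_ρ(hol_w ∘ lift)⟩_{L,β}`, and every product of Polyakov-line
characters has the same expectation at `β` and `-β`. Here the two families of the cell:

* `wilsonExpectation_character_walkHolonomy_neg_suEven`, `wilsonExpectation_prod_polyakovLines_neg_suEven`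
  — `SU(M)`, `M` even (so the cell's `SU(2)`), `z = -1`, tree coupling `β`;
* `wilsonExpectation_character_walkHolonomy_neg_uN`, `wilsonExpectation_prod_polyakovLines_neg_uN` —
  `U(N)` in the defining representation.

What is NOT claimed: nothing for `SU(2n+1)` (no central involution with `ρ z = -1`), nothing for odd
`L`; no bound. [folklore] bookkeeping (Kogut–Susskind 1975; Li–Meurice 2005 §II).
-/

noncomputable section

open MeasureTheory Filter Topology SimpleGraph
open Literature.Probability.LatticeModels (Site zdGraph Torus.proj)
open Literature.MathematicalPhysics.QuantumLattice
open Literature.MathematicalPhysics.QuantumFieldTheory (GaugeConfig wilsonMeasure wilsonExpectation)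

namespace Summit.QuantumFields.GaugeBoot

namespace TiltedRP

variable {d : ℕ}

/-! ## The cell's gauge groups: `SU(2n)` and `U(N)` -/

section Groups

open Literature.MathematicalPhysics.QuantumLattice (fundamentalRep unitaryFundamentalRep
  continuous_fundamentalRep continuous_unitaryFundamentalRep)

variable {L : ℕ} [NeZero L] {π : Fin d → Site d →+ ZMod 2}

/-- ★★ **`SU(M)`, `M` even (so `SU(2)`): every closed torus loop at `-β_tree` is `(-1)^{a(w)}` times
the same loop at `β_tree`** on the even torus `(ℤ/L)^d`, every `d`, every real `β`. -/
theorem wilsonExpectation_character_walkHolonomy_neg_suEven {M : ℕ} (hM : Even M)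
    (hπ : IsDualParity (zdUnit d) π) (h2 : 2 ∣ L) (β : ℝ) {x y : Site d}
    (w : (zdGraph d).Walk x y) (hxy : Torus.proj L y = Torus.proj L x) :
    wilsonExpectation (L := L) (fundamentalRep (Fin M)) (-β)
        (fun U => normalisedCharacter M (fundamentalRep (Fin M) (walkHolonomy (torusLift L U) w))) =
      (-1 : ℝ) ^ (areaParity π w).val *
        wilsonExpectation (L := L) (fundamentalRep (Fin M)) β
          (fun U => normalisedCharacter M (fundamentalRep (Fin M) (walkHolonomy (torusLift L U) w))) :=
  wilsonExpectation_character_walkHolonomy_neg_of_proj_eq (fundamentalRep (Fin M))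
    (z := ⟨-1, neg_one_mem_specialUnitaryGroup_of_even hM⟩) hπ h2 (continuous_fundamentalRep (Fin M))
    (fun g => Subtype.ext (by simp)) (Subtype.ext (by simp)) (by rw [fundamentalRep_apply]) β w hxy

/-- ★★ **`SU(M)`, `M` even: Polyakov loop correlators are even in `β_tree`** on the even torus. -/
theorem wilsonExpectation_prod_polyakovLines_neg_suEven {M : ℕ} (hM : Even M)
    (hπ : IsDualParity (zdUnit d) π) (h2 : 2 ∣ L) (β : ℝ) {n : ℕ} (μ : Fin n → Fin d)
    (x : Fin n → Site d) :
    wilsonExpectation (L := L) (fundamentalRep (Fin M)) (-β)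
        (fun U => ∏ a, normalisedCharacter M
          (fundamentalRep (Fin M) (walkHolonomy (torusLift L U) (lineWalk (μ a) L (x a))))) =
      wilsonExpectation (L := L) (fundamentalRep (Fin M)) β
        (fun U => ∏ a, normalisedCharacter M
          (fundamentalRep (Fin M) (walkHolonomy (torusLift L U) (lineWalk (μ a) L (x a))))) := by
  classical
  rcases isEmpty_or_nonempty (Fin d) with hd | ⟨⟨r⟩⟩
  · -- `d = 0`: there are no directions, so the family of lines is empty unless `n = 0`
    rcases Nat.eq_zero_or_pos n with hn | hn
    · subst hn
      haveI := Literature.MathematicalPhysics.QuantumFieldTheory.isProbabilityMeasure_wilsonMeasure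
        (d := d) (L := L) (fundamentalRep (Fin M)) (continuous_fundamentalRep (Fin M)) β
      haveI := Literature.MathematicalPhysics.QuantumFieldTheory.isProbabilityMeasure_wilsonMeasure
        (d := d) (L := L) (fundamentalRep (Fin M)) (continuous_fundamentalRep (Fin M)) (-β)
      simp [wilsonExpectation]
    · exact (hd.false (μ ⟨0, hn⟩)).elim
  · exact wilsonExpectation_prod_polyakovLines_neg (fundamentalRep (Fin M))
      (z := ⟨-1, neg_one_mem_specialUnitaryGroup_of_even hM⟩) hπ h2 r (continuous_fundamentalRep (Fin M))
      (fun g => Subtype.ext (by simp)) (Subtype.ext (by simp)) (by rw [fundamentalRep_apply]) β μ x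

/-- ★★ **`U(N)`: every closed torus loop at `-β` is `(-1)^{a(w)}` times the same loop at `β`.** -/
theorem wilsonExpectation_character_walkHolonomy_neg_uN {N : ℕ} (hπ : IsDualParity (zdUnit d) π)
    (h2 : 2 ∣ L) (β : ℝ) {x y : Site d} (w : (zdGraph d).Walk x y)
    (hxy : Torus.proj L y = Torus.proj L x) :
    wilsonExpectation (L := L) (unitaryFundamentalRep (Fin N) ℂ) (-β)
        (fun U => normalisedCharacter N
          (unitaryFundamentalRep (Fin N) ℂ (walkHolonomy (torusLift L U) w))) =
      (-1 : ℝ) ^ (areaParity π w).val *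
        wilsonExpectation (L := L) (unitaryFundamentalRep (Fin N) ℂ) β
          (fun U => normalisedCharacter N
            (unitaryFundamentalRep (Fin N) ℂ (walkHolonomy (torusLift L U) w))) :=
  wilsonExpectation_character_walkHolonomy_neg_of_proj_eq (unitaryFundamentalRep (Fin N) ℂ)
    (z := ⟨-1, by simp [Matrix.mem_unitaryGroup_iff]⟩) hπ h2 (continuous_unitaryFundamentalRep (Fin N) ℂ)
    (fun g => Subtype.ext (by simp)) (Subtype.ext (by simp)) rfl β w hxy

/-- ★★ **`U(N)`: Polyakov loop correlators are even in `β`** on the even torus (`d ≥ 1`). -/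
theorem wilsonExpectation_prod_polyakovLines_neg_uN {N : ℕ} [NeZero d]
    (hπ : IsDualParity (zdUnit d) π) (h2 : 2 ∣ L) (β : ℝ) {n : ℕ} (μ : Fin n → Fin d)
    (x : Fin n → Site d) :
    wilsonExpectation (L := L) (unitaryFundamentalRep (Fin N) ℂ) (-β)
        (fun U => ∏ a, normalisedCharacter N
          (unitaryFundamentalRep (Fin N) ℂ (walkHolonomy (torusLift L U) (lineWalk (μ a) L (x a))))) =
      wilsonExpectation (L := L) (unitaryFundamentalRep (Fin N) ℂ) β
        (fun U => ∏ a, normalisedCharacter N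
          (unitaryFundamentalRep (Fin N) ℂ (walkHolonomy (torusLift L U) (lineWalk (μ a) L (x a))))) :=
  wilsonExpectation_prod_polyakovLines_neg (unitaryFundamentalRep (Fin N) ℂ)
    (z := ⟨-1, by simp [Matrix.mem_unitaryGroup_iff]⟩) hπ h2 (0 : Fin d)
    (continuous_unitaryFundamentalRep (Fin N) ℂ) (fun g => Subtype.ext (by simp)) (Subtype.ext (by simp))
    rfl β μ x

end Groups

end TiltedRP

end Summit.QuantumFields.GaugeBoot
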